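import Summits.QuantumAdvantage.QuantumAdvantage.Theorems.FlatDialTrilin
import Summits.QuantumAdvantage.QuantumAdvantage.Theorems.HintDialClosure

/-!
# FlatDialTables — module 13 of the lens-3 g11 «FlatDial» THEOREMS package (cell decomp-qadv): the TABLE LEVEL (ii) and ★★★ the `M`-recovery instance

Completes record §12: the planted family `G_w := cubeMM (m+1) ∘ frameA w` (modules 8, 11) is PRESENTED BY A CUBIC TABLE whose every coefficient is an
`AC⁰[⊕]` function (depth `4`) of the seed `w`, its dual partner is presented by a cubic table too, and together with modules 9–11 this yields a complete
`MRecovery` (module 5 schema) — hence ★★★ `no_mfinder` : NO composition-closed `AC⁰[⊕]` family finds valid `M`-certificates of all `MM#` signed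
cubic duals (`no_mfinder_of_mRecovery`).  This is the BC5 rung `Nonempty MRecovery` of the FlatDial route on `AnfPresentation:27991`, LANDED.

* §1 the quadratic ANF tables `bq` / `bqi` of the cube key `q` and of its inverse `qi` (finite checks `dec_q_eq`, `dec_qi_eq`), and the TRILINEAR
  expansions `bit_cubeMM_tri`, `bit_cubeMMDual_tri` of `cubeMM r`, `cubeMMDual r`.
* §2 the framed tables: `rowA w d` (rows of `frameA w`: `frameA_eq_bd`), ★ `tabForm w` with `eval_tabForm : (tabForm w).eval = G_w`, the dual
  table `dualForm w` with `eval_dualForm`, ★ `tab_mem_signedCubicDuals`.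
* §3 realisability: every row entry is a LITERAL of `w` (`isLit_rowA`), so every coefficient of `tabForm w` — a parity of `27(m+1)` threefold ANDs of
  literals — is `AC⁰[⊕]` of depth `4`, size `189(m+1)+1` (`acRealOver_cube`); the planted coefficient string `plant` and `plantAC`; the extractor bound
  `extractB_realisable`.
* §4 ★★★ `mRecovery : MRecovery`, `nonempty_mRecovery`, `no_mfinder`.

ZERO `def X : Prop`.  Provenance: HOME/decomp-qadv-lens-3/g11/ (record NODE-g11.md §12, LAND-g11.md step 13).
-/

set_option linter.dupNamespace false

noncomputable section

namespace Summit.QuantumAdvantage.QuantumAdvantage.Theorems.FlatDial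

open Finset Polynomial
open Literature.Computability.Complexity
open Literature.Computability.QuantumComplexity
open Literature.Computability.MetaComplexity
open Literature.Computability.QuantumComplexity.BuzetChailloux (bxor zeroVec)
open Summit.QuantumAdvantage.QuantumAdvantage.Theorems.HintDial (IsDualOf bit_and bit_injective)
open Summit.QuantumAdvantage.QuantumAdvantage.Theorems.HintDial.Automaton (bd sgl bd_sgl_right bit_bd kk nd a₀ b₀ QQ IsLit isLit_qEnt
  acRealOver_evalLit bd_zeroVec_right)
open CubicForm (bit)
open LemmaU (B)

/-! ## 1. The ANF of the cube key and the trilinear expansion of `cubeMM`, `cubeMMDual` -/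

section Anf

variable {r : ℕ}

/-- the quadratic ANF table of the cube key: `q(v)_t = ⊕_{s₁,s₂} bq t s₁ s₂ · v_{s₁} v_{s₂}` (upper triangular; diagonal = linear terms). -/
def bq : Fin 3 → Fin 3 → Fin 3 → Bool :=
  ![![![true, false, false], ![false, true, true], ![false, false, true]],
    ![![false, true, false], ![false, false, false], ![false, false, true]],
    ![![false, true, true], ![false, true, false], ![false, false, false]]]

/-- the quadratic ANF table of the inverse cube key `qi`. -/
def bqi : Fin 3 → Fin 3 → Fin 3 → Bool :=
  ![![![true, false, false], ![false, true, true], ![false, false, true]],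
    ![![false, true, false], ![false, true, false], ![false, false, true]],
    ![![false, true, true], ![false, false, false], ![false, false, true]]]

/-- the ANF of `q` (finite check). -/
theorem dec_q_eq (v : B) (t : Fin 3) :
    dec (q v) t = decide (Odd (univ.filter fun p : Fin 3 × Fin 3 => (bq t p.1 p.2 && (dec v p.1 && dec v p.2)) = true).card) := by
  revert v t; decide +kernel

/-- the ANF of `qi` (finite check). -/
theorem dec_qi_eq (v : B) (t : Fin 3) :
    dec (qi v) t = decide (Odd (univ.filter fun p : Fin 3 × Fin 3 => (bqi t p.1 p.2 && (dec v p.1 && dec v p.2)) = true).card) := by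
  revert v t; decide +kernel

/-- `cubeMMDual` as a dot product. -/
theorem cubeMMDual_eq_bd (u : Fin (r * 3 + r * 3) → Bool) :
    cubeMMDual r u = bd (cubeKeyInv fun i => u (Fin.castAdd (r * 3) i)) (fun i => u (Fin.natAdd (r * 3) i)) := by
  rw [cubeMMDual, mmDualFn, Bool.xor_false]

/-- ★ THE TRILINEAR EXPANSION of `cubeMM r`: `Σ_{j,t,s₁,s₂} bq t s₁ s₂ · x_{j,t} · z_{j,s₁} · z_{j,s₂}` (bits in `ZMod 2`). -/
theorem bit_cubeMM_tri (y : Fin (r * 3 + r * 3) → Bool) :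
    bit (cubeMM r y) = ∑ τ : Fin r × Fin 3 × Fin 3 × Fin 3, bit (bq τ.2.1 τ.2.2.1 τ.2.2.2) *
      (bit (y (Fin.castAdd (r * 3) (finProdFinEquiv (τ.1, τ.2.1)))) *
        (bit (y (Fin.natAdd (r * 3) (finProdFinEquiv (τ.1, τ.2.2.1)))) * bit (y (Fin.natAdd (r * 3) (finProdFinEquiv (τ.1, τ.2.2.2)))))) := by
  rw [cubeMM_eq_bd, bit_bd, ← Equiv.sum_comp finProdFinEquiv]
  simp only [Fintype.sum_prod_type]
  refine sum_congr rfl fun j _ => sum_congr rfl fun t _ => ?_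
  rw [cubeKey, unblk_apply, dec_q_eq, bit_odd_card]
  simp only [Fintype.sum_prod_type, bit_and, dec_blk, mul_sum]
  exact sum_congr rfl fun s₁ _ => sum_congr rfl fun s₂ _ => by ring

/-- ★ THE TRILINEAR EXPANSION of `cubeMMDual r`: `Σ_{j,t,s₁,s₂} bqi t s₁ s₂ · z_{j,t} · x_{j,s₁} · x_{j,s₂}`. -/
theorem bit_cubeMMDual_tri (u : Fin (r * 3 + r * 3) → Bool) :
    bit (cubeMMDual r u) = ∑ τ : Fin r × Fin 3 × Fin 3 × Fin 3, bit (bqi τ.2.1 τ.2.2.1 τ.2.2.2) *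
      (bit (u (Fin.natAdd (r * 3) (finProdFinEquiv (τ.1, τ.2.1)))) *
        (bit (u (Fin.castAdd (r * 3) (finProdFinEquiv (τ.1, τ.2.2.1)))) * bit (u (Fin.castAdd (r * 3) (finProdFinEquiv (τ.1, τ.2.2.2)))))) := by
  rw [cubeMMDual_eq_bd, bd_comm, bit_bd, ← Equiv.sum_comp finProdFinEquiv]
  simp only [Fintype.sum_prod_type]
  refine sum_congr rfl fun j _ => sum_congr rfl fun t _ => ?_
  rw [cubeKeyInv, unblk_apply, dec_qi_eq, bit_odd_card]
  simp only [Fintype.sum_prod_type, bit_and, dec_blk, mul_sum]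
  exact sum_congr rfl fun s₁ _ => sum_congr rfl fun s₂ _ => by ring

end Anf

/-! ## 2. The framed tables -/

section Tables

variable {m : ℕ} (w : Fin m → Bool)

/-- the index type of the trilinear terms: (block, output bit, two input bits). -/
abbrev Tm (m : ℕ) : Type := Fin (m + 1) × Fin 3 × Fin 3 × Fin 3

/-- row `d` of the frame matrix: `(frameA w y)_d = ⟨rowA w d, y⟩`. -/
def rowA (d : Fin (kk m + kk m)) : Fin (kk m + kk m) → Bool := fun c => frameA w (sgl c) d

/-- the frame is the linear map with rows `rowA w`. -/
theorem frameA_eq_bd (y : Fin (kk m + kk m) → Bool) (d : Fin (kk m + kk m)) : frameA w y d = bd (rowA w d) y :=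
  apply_eq_bd_of_add (φ := fun y => frameA w y d) (fun x y => by rw [frameA_bxor]) y

/-- row `d` of the ADJOINT frame: `(adjOf (frameA w) v)_d = ⟨rowC w d, v⟩`. -/
def rowC (d : Fin (kk m + kk m)) : Fin (kk m + kk m) → Bool := (frameA w).symm (sgl d)

/-- the adjoint frame is the linear map with rows `rowC w`. -/
theorem adjOf_frameA_eq_bd (v : Fin (kk m + kk m) → Bool) (d : Fin (kk m + kk m)) : adjOf (frameA w) v d = bd (rowC w d) v :=
  bd_comm _ _

/-- the three linear forms of term `τ` of the planted table: an `x`-row and two `z`-rows of the frame. -/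
def uTab (τ : Tm m) : Fin 3 → Fin (kk m + kk m) → Bool
  | 0 => rowA w (Fin.castAdd (kk m) (finProdFinEquiv (τ.1, τ.2.1)))
  | 1 => rowA w (Fin.natAdd (kk m) (finProdFinEquiv (τ.1, τ.2.2.1)))
  | 2 => rowA w (Fin.natAdd (kk m) (finProdFinEquiv (τ.1, τ.2.2.2)))

/-- the three linear forms of term `τ` of the dual table: a `z`-row and two `x`-rows of the adjoint frame. -/
def uDual (τ : Tm m) : Fin 3 → Fin (kk m + kk m) → Bool
  | 0 => rowC w (Fin.natAdd (kk m) (finProdFinEquiv (τ.1, τ.2.1)))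
  | 1 => rowC w (Fin.castAdd (kk m) (finProdFinEquiv (τ.1, τ.2.2.1)))
  | 2 => rowC w (Fin.castAdd (kk m) (finProdFinEquiv (τ.1, τ.2.2.2)))

/-- ★ THE PLANTED CUBIC TABLE of `G_w = cubeMM (m+1) ∘ frameA w`. -/
def tabForm : CubicForm (kk m + kk m) := triForm (kk m + kk m) (fun τ : Tm m => bq τ.2.1 τ.2.2.1 τ.2.2.2) (uTab w)

/-- the cubic table of the dual partner `cubeMMDual (m+1) ∘ adjOf (frameA w)`. -/
def dualForm : CubicForm (kk m + kk m) := triForm (kk m + kk m) (fun τ : Tm m => bqi τ.2.1 τ.2.2.1 τ.2.2.2) (uDual w)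

/-- ★★ the planted table PRESENTS `G_w`. -/
theorem eval_tabForm : (tabForm w).eval = fun y => cubeMM (m + 1) (frameA w y) := by
  funext y
  rw [tabForm, eval_triForm]
  apply bit_injective
  rw [bit_odd_card, bit_cubeMM_tri]
  refine sum_congr rfl fun τ _ => ?_
  simp only [bit_and, uTab, ← frameA_eq_bd]

/-- the dual table presents the dual partner. -/
theorem eval_dualForm : (dualForm w).eval = fun v => cubeMMDual (m + 1) (adjOf (frameA w) v) := by
  funext v
  rw [dualForm, eval_triForm]
  apply bit_injective
  rw [bit_odd_card, bit_cubeMMDual_tri]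
  refine sum_congr rfl fun τ _ => ?_
  simp only [bit_and, uDual, ← adjOf_frameA_eq_bd]

/-- `G_w` and `cubeMMDual ∘ adjOf (frameA w)` are a dual pair (Walsh covariance, module 12). -/
theorem isDualOf_tab : IsDualOf (fun y => cubeMM (m + 1) (frameA w y)) fun v => cubeMMDual (m + 1) (adjOf (frameA w) v) :=
  isDualOf_precomp isDualOf_cubeMM (frameA w) (adjOf (frameA w)) (bd_adjOf (frameA w) (frameA_bxor w))

/-- ★ `G_w` is a signed cubic dual, with an EXPLICIT cubic partner table. -/
theorem tab_mem_signedCubicDuals : (fun y => cubeMM (m + 1) (frameA w y)) ∈ signedCubicDuals (kk m + kk m) :=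
  mem_signedCubicDuals_of_isDualOf (isDualOf_tab w) (dualForm w) (eval_dualForm w)

end Tables

/-! ## 3. Realisability: the coefficients are `AC⁰[⊕]` functions of the seed -/

section Realise

variable {m : ℕ}

/-- a literal is an `AC⁰[⊕]` function of depth `1`, size `1`. -/
theorem acRealOver_of_isLit {g : (Fin m → Bool) → Bool} (h : IsLit g) : ACRealOver (accBasis 2) g 1 1 := by
  obtain ⟨ℓ, hℓ⟩ := h
  exact (acRealOver_evalLit 2 ℓ).congr fun w => (hℓ w).symm

/-- `⟨QQ_w a, (e_c)″⟩` is a literal of `w`: one entry of `QQ w` or the constant `0`. -/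
theorem isLit_bd_QQ_sgl (a : Fin (kk m)) (c : Fin (kk m + kk m)) :
    IsLit fun w : Fin m → Bool => bd (QQ w a) fun b => sgl c (Fin.natAdd (kk m) b) := by
  refine Fin.addCases (fun a' => ?_) (fun b' => ?_) c
  · refine (IsLit.const false).congr fun w => ?_
    have e : (fun b => sgl (Fin.castAdd (kk m) a') (Fin.natAdd (kk m) b)) = zeroVec := funext fun b => decide_eq_false fun h => by
      have h' := congrArg Fin.val h
      simp only [Fin.val_natAdd, Fin.val_castAdd] at h'
      omega
    rw [e, bd_zeroVec_right]
  · refine (isLit_qEnt (nd.symm a) (nd.symm b')).congr fun w => ?_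
    have e : (fun b => sgl (Fin.natAdd (kk m) b') (Fin.natAdd (kk m) b)) = sgl b' := funext fun b => by
      show decide (_ = _) = decide (_ = _)
      by_cases h : b = b'
      · rw [h, decide_eq_true rfl, decide_eq_true rfl]
      · rw [decide_eq_false h, decide_eq_false fun e => h (Fin.ext ?_)]
        have h' := congrArg Fin.val e
        simp only [Fin.val_natAdd] at h'
        omega
    rw [e, bd_sgl_right]
    rfl

/-- ★ every entry of every row of the frame is a LITERAL of the seed. -/
theorem isLit_rowA (d c : Fin (kk m + kk m)) : IsLit fun w : Fin m → Bool => rowA w d c := by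
  refine Fin.addCases (fun a => ?_) (fun b => ?_) d
  · by_cases ha : a = a₀
    · exact (isLit_bd_QQ_sgl a₀ c).congr fun w => by show frameA w (sgl c) _ = _; rw [frameA_x, if_pos ha]
    · exact (IsLit.const (sgl c (Fin.castAdd (kk m) a))).congr fun w => by show frameA w (sgl c) _ = _; rw [frameA_x, if_neg ha]
  · by_cases hb : b = a₀
    · exact (IsLit.const (sgl c (Fin.castAdd (kk m) a₀))).congr fun w => by show frameA w (sgl c) _ = _; rw [frameA_z, if_pos hb]
    · exact (isLit_bd_QQ_sgl b c).congr fun w => by show frameA w (sgl c) _ = _; rw [frameA_z, if_neg hb]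

/-- every entry of the three linear forms of a term is a literal. -/
theorem isLit_uTab (τ : Tm m) (s : Fin 3) (c : Fin (kk m + kk m)) : IsLit fun w : Fin m → Bool => uTab w τ s c := by
  fin_cases s <;> exact isLit_rowA _ c

/-- one trilinear term of a coefficient: depth `3`, size `7`. -/
theorem acRealOver_term (κ : Tm m → Bool) (τ : Tm m) (i j l : Fin (kk m + kk m)) :
    ACRealOver (accBasis 2) (fun w : Fin m → Bool => κ τ && (uTab w τ 0 i && (uTab w τ 1 j && uTab w τ 2 l))) 3 7 := by
  have h1 := acRealOver_of_isLit (isLit_uTab τ 0 i)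
  have h23 := acRealOver_and2 (acRealOver_of_isLit (isLit_uTab τ 1 j)) (acRealOver_of_isLit (isLit_uTab τ 2 l))
  have h := acRealOver_and2 (h1.mono (by norm_num) (by norm_num)) h23
  cases hk : κ τ
  · exact ((acRealOver_const (acBasis_subset_accBasis 2) false).mono (by norm_num) (by norm_num)).congr fun w => by
      rw [Bool.false_and]
  · exact h.congr fun w => by rw [Bool.true_and]

/-- ★ EVERY COEFFICIENT of the planted table is an `AC⁰[⊕]` function of the seed: depth `4`, size `189(m+1)+1` (`27(m+1)` terms). -/
theorem acRealOver_cube (i j l : Fin (kk m + kk m)) :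
    ACRealOver (accBasis 2) (fun w : Fin m → Bool => (tabForm w).cube i j l) 4 (27 * (m + 1) * 7 + 1) := by
  let e := Fintype.equivFin (Tm m)
  have h := acRealOver_parity (M := Fintype.card (Tm m))
    (f := fun k w => bq (e.symm k).2.1 (e.symm k).2.2.1 (e.symm k).2.2.2 && (uTab w (e.symm k) 0 i && (uTab w (e.symm k) 1 j && uTab w (e.symm k) 2 l)))
    fun k => acRealOver_term (fun τ => bq τ.2.1 τ.2.2.1 τ.2.2.2) (e.symm k) i j l
  have card_Tm : Fintype.card (Tm m) = 27 * (m + 1) := by simp only [Tm, Fintype.card_prod, Fintype.card_fin]; ring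
  refine (h.mono le_rfl (by rw [card_Tm])).congr fun w => ?_
  show _ = decide (Odd (univ.filter fun τ : Tm m => _ = true).card)
  congr 2
  rw [GateFn.numOnes]
  exact (Finset.card_equiv e fun τ => by simp only [mem_filter, mem_univ, true_and, Equiv.symm_apply_apply]).symm

/-- ★ THE PLANTED COEFFICIENT STRING (`gform` encoding) of `G_w`. -/
def plant (m : ℕ) (w : Fin m → Bool) (k : Fin (formN (kk m + kk m))) : Bool :=
  ((formEquiv (kk m + kk m)).symm k).elim false fun ijl => (tabForm w).cube ijl.1 ijl.2.1 ijl.2.2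

/-- decoding the planted string gives the planted table. -/
theorem gformOf_plant (w : Fin m → Bool) : gformOf (kk m + kk m) (plant m w) = tabForm w := by
  simp only [gformOf, plant, Equiv.symm_apply_apply, Option.elim]
  rfl

/-- ★ `plantAC`: every bit of the planted string is an `AC⁰[⊕]` function of the seed (depth `4`, size `189·m + 190`). -/
theorem plantAC (m : ℕ) (k : Fin (formN (kk m + kk m))) :
    ACRealOver (accBasis 2) (fun w : Fin m → Bool => plant m w k) 4 ((189 * X + 190 : Polynomial ℕ).eval m) := by
  have hs : (189 * X + 190 : Polynomial ℕ).eval m = 27 * (m + 1) * 7 + 1 := by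
    simp only [eval_add, eval_mul, eval_X, eval_ofNat]; ring
  rw [hs]
  unfold plant
  cases (formEquiv (kk m + kk m)).symm k with
  | none => exact (acRealOver_const (acBasis_subset_accBasis 2) false).mono (by norm_num) (by omega)
  | some ijl => exact acRealOver_cube ijl.1 ijl.2.1 ijl.2.2

/-- ★ the extractor `extractB` (one OR over the `b₀″`-column of the rows) is composition-closed realisable: depth `+1`, size `(3m+4)·(s+1)`. -/
theorem extractB_realisable (m : ℕ) (c : (Fin m → Bool) → CertIdx (kk m + kk m) → Bool) (dc sc : ℕ)
    (hc : ∀ k, ACRealOver (accBasis 2) (fun w => c w k) dc sc) :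
    ACRealOver (accBasis 2) (fun w => extractB (c w)) (1 + dc) ((3 * X + 4 : Polynomial ℕ).eval m * (sc + 1)) := by
  have h := acRealOver_exists_const (acBasis_subset_accBasis 2)
    (f := fun (k : Fin ((kk m + kk m) / 2)) w => c w (Sum.inr (Sum.inl (k, Fin.natAdd (kk m) b₀)))) fun k => hc _
  have hK : (kk m + kk m) / 2 = 3 * m + 3 := by simp only [kk]; omega
  have hs : (3 * X + 4 : Polynomial ℕ).eval m = 3 * m + 4 := by simp only [eval_add, eval_mul, eval_X, eval_ofNat]
  rw [hs]
  refine (h.mono (by omega) ?_).congr fun w => ?_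
  · rw [hK]; nlinarith [Nat.zero_le (m * sc), Nat.zero_le sc, Nat.zero_le m]
  · rfl

end Realise

/-! ## 4. ★★★ The `M`-recovery family -/

/-- ★★★ THE `M`-RECOVERY FAMILY of record §12: `G_w = cubeMM (m+1) ∘ frameA w` on `6(m+1)` variables, planted at depth `4`, read out by one OR gate;
every valid `M`-certificate of `G_w` carries `MOD₃(w)`. -/
def mRecovery : MRecovery where
  N m := kk m + kk m
  P := 6 * X + 6
  hN m := by
    show (m + 1) * 3 + (m + 1) * 3 ≤ (6 * X + 6 : Polynomial ℕ).eval m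
    simp only [eval_add, eval_mul, eval_X, eval_ofNat]; omega
  even m := ⟨kk m, rfl⟩
  plant := plant
  dP := 4
  rP := 189 * X + 190
  plantAC := plantAC
  dual m w := by rw [gformOf_plant, eval_tabForm]; exact tab_mem_signedCubicDuals w
  msub m w := by rw [gformOf_plant, eval_tabForm]; exact cubeMM_frameA_mem_hasMSub w
  E m _ c := extractB c
  dE := 1
  rE := 3 * X + 4
  hE := extractB_realisable
  recover m w c hc := by
    rw [gformOf_plant, eval_tabForm] at hc
    exact extractB_eq w hc

/-- the BC5 rung of the FlatDial route: the `M`-recovery family EXISTS. -/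
theorem nonempty_mRecovery : Nonempty MRecovery := ⟨mRecovery⟩

/-- ★★★ NO composition-closed `AC⁰[⊕]` family of certificate maps finds a valid `M`-certificate of every `MM#` signed cubic dual (module 5 +
the `M`-recovery family): the certificate level of `W` (record §11–§12) is DECIDED for `M`-certificates. -/
theorem no_mfinder :
    ¬ ∃ c : (n : ℕ) → (Fin (formN n) → Bool) → CertIdx n → Bool, c ∈ realisableOutG CertIdx ∧ c ∈ mfinders :=
  no_mfinder_of_mRecovery mRecovery

end Summit.QuantumAdvantage.QuantumAdvantage.Theorems.FlatDial
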